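import Mathlib
import HarnessLib

/-!
# TASK T-S5/U5.4h «odd perturbation bounds» — the parity step of the Laplace asymptotics made exact (planner ym-idea-2 g17,
# 2026-08-29T17:13:39Z) — step (1b) of the comparison stubs S5 (LINE-19 ⟨stmt-QuantumFields-24004⟩/⟨24335⟩) and U5 (LINE-20 ⟨24336⟩)

Free-hands work of width seat `ym-line-sfw-p2-w3` (g39, cell `ym-idea-1`).  In the assembly of T-S5.4 (`Cruxes/BoxWindowHighSU2213/STUB-PLAN-S5U5-STEP1b.md`
§3) the cubic part `T = β^{−1/2}·T₃(v)` of the Faddeev–Popov weight is ODD under `v ↦ −v` while the Gaussian reference measure is EVEN; then the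
perturbed mass `∫ e^{−T} dμ` needs no Taylor bookkeeping:

  `μ(univ) ≤ ∫ e^{−T} dμ ≤ ∫ e^{T²/2} dμ`,

because symmetrisation gives `∫ e^{−T} dμ = ∫ cosh T dμ` and `1 ≤ cosh t ≤ e^{t²/2}` (Mathlib `Real.one_le_cosh`, `Real.cosh_le_exp_half_sq`).  The Prop
`OddPerturbationBounds` is the planner's text VERBATIM.  Mathlib only; no `sorry`.

HONEST LABEL: an S brick of step (1b); T-S5.4 proper, S5, U5, ⟨24004⟩ ⟨24335⟩ ⟨24336⟩ remain OPEN; no crux, rung or summit is proved; the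
Yang–Mills mass gap is NOT proved by this file.
-/

set_option autoImplicit false

noncomputable section

open MeasureTheory Real Filter

namespace Summit.QuantumFields.YangMills.Theorems.AllWindowsColdBoxBoxHighLine

/-- T-S5.4h **(odd perturbation bounds; S)**: for a finite measure `μ` on `ℝⁿ` symmetric under `v ↦ −v` and an odd measurable `T` with
`e^{T²/2} ∈ L¹(μ)`: `μ(univ) ≤ ∫ e^{−T} dμ ≤ ∫ e^{T²/2} dμ` (planner ym-idea-2 g17, 2026-08-29T17:13:39Z, verbatim). -/
def OddPerturbationBounds : Prop :=
  ∀ (n : ℕ) (μ : MeasureTheory.Measure (Fin n → ℝ)) [MeasureTheory.IsFiniteMeasure μ], μ.map (fun v => -v) = μ →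
    ∀ T : (Fin n → ℝ) → ℝ, Measurable T → (∀ v, T (-v) = -T v) → MeasureTheory.Integrable (fun v => Real.exp (T v ^ 2 / 2)) μ →
      (μ Set.univ).toReal ≤ ∫ v, Real.exp (-T v) ∂μ ∧ ∫ v, Real.exp (-T v) ∂μ ≤ ∫ v, Real.exp (T v ^ 2 / 2) ∂μ

/-- `e^{t} ≤ 2 cosh t ≤ 2 e^{t²/2}`: the domination used for integrability of `e^{±T}`. -/
theorem exp_le_two_mul_exp_half_sq (t : ℝ) : Real.exp t ≤ 2 * Real.exp (t ^ 2 / 2) := by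
  have h1 : Real.exp t ≤ 2 * Real.cosh t := by
    rw [Real.cosh_eq]
    have := Real.exp_pos (-t)
    linarith
  exact h1.trans (by linarith [Real.cosh_le_exp_half_sq t, Real.exp_pos (t ^ 2 / 2)])

/-- ★ **T-S5.4h «ODD PERTURBATION BOUNDS», BY NAME.** [folklore] -/
theorem oddPerturbationBounds : OddPerturbationBounds := by
  intro n μ _ hμ T hT hodd hint
  -- integrability of `e^{±T}` by domination with `2 e^{T²/2}`
  have hdom : ∀ s : ℝ, (s = 1 ∨ s = -1) → Integrable (fun v => Real.exp (s * T v)) μ := by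
    intro s hs
    refine (hint.const_mul 2).mono' ((measurable_const.mul hT).exp.aestronglyMeasurable) (Eventually.of_forall fun v => ?_)
    rw [Real.norm_eq_abs, abs_of_pos (Real.exp_pos _)]
    have h := exp_le_two_mul_exp_half_sq (s * T v)
    have hsq : (s * T v) ^ 2 = T v ^ 2 := by
      rcases hs with h1 | h1 <;> rw [h1] <;> ring
    rw [hsq] at h
    exact h
  have hpos : Integrable (fun v => Real.exp (T v)) μ := by
    have := hdom 1 (Or.inl rfl); simpa using this
  have hneg : Integrable (fun v => Real.exp (-T v)) μ := by
    have := hdom (-1) (Or.inr rfl); simpa using this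
  -- symmetrisation: `∫ e^{−T} dμ = ∫ e^{T} dμ`
  have hsymm : ∫ v, Real.exp (-T v) ∂μ = ∫ v, Real.exp (T v) ∂μ := by
    have hneg_meas : AEMeasurable (fun v : Fin n → ℝ => -v) μ := measurable_neg.aemeasurable
    calc ∫ v, Real.exp (-T v) ∂μ = ∫ v, Real.exp (-T v) ∂(μ.map fun v => -v) := by rw [hμ]
      _ = ∫ v, Real.exp (-T (-v)) ∂μ := by
          rw [integral_map hneg_meas]
          exact (hT.neg.exp.aestronglyMeasurable)
      _ = ∫ v, Real.exp (T v) ∂μ := by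
          refine integral_congr_ae (Eventually.of_forall fun v => ?_)
          simp only [hodd v, neg_neg]
  -- hence `∫ e^{−T} = ∫ cosh T`
  have hcosh : ∫ v, Real.exp (-T v) ∂μ = ∫ v, Real.cosh (T v) ∂μ := by
    have h2 : ∫ v, Real.cosh (T v) ∂μ = ((∫ v, Real.exp (T v) ∂μ) + ∫ v, Real.exp (-T v) ∂μ) / 2 := by
      simp_rw [Real.cosh_eq]
      rw [integral_div, integral_add hpos hneg]
    rw [h2, hsymm]
    ring
  have hcosh_int : Integrable (fun v => Real.cosh (T v)) μ := by
    have : (fun v => Real.cosh (T v)) = fun v => ((Real.exp (T v)) + Real.exp (-T v)) / 2 := by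
      funext v; rw [Real.cosh_eq]
    rw [this]
    exact (hpos.add hneg).div_const 2
  rw [hcosh]
  constructor
  · -- lower bound: `1 ≤ cosh`
    have h := integral_mono (integrable_const (1 : ℝ)) hcosh_int (fun v => Real.one_le_cosh (T v))
    have h1 : ∫ _ : Fin n → ℝ, (1 : ℝ) ∂μ = (μ Set.univ).toReal := by
      rw [integral_const, smul_eq_mul, mul_one, Measure.real]
    rw [h1] at h
    exact h
  · -- upper bound: `cosh t ≤ e^{t²/2}`
    exact integral_mono hcosh_int hint (fun v => Real.cosh_le_exp_half_sq (T v))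

end Summit.QuantumFields.YangMills.Theorems.AllWindowsColdBoxBoxHighLine

end
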